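import Literature.AlgebraicGeometry.HodgeTheory.DiagonalSymmetry
import Literature.AlgebraicGeometry.HodgeTheory.AlgebraicClasses
import Literature.AlgebraicGeometry.HodgeTheory.RationalHodgeClasses
import Mathlib.GroupTheory.FiniteAbelian.Duality
import Mathlib.RingTheory.RootsOfUnity.AlgebraicallyClosed
import Mathlib.Analysis.Complex.Polynomial.Basic
import HarnessLib

/-!
# Character eigenspaces of a finite group of diagonal symmetries on `Hᵏ(X_F(ℂ); ℂ)`

Family `hodge`, layer `Literature/AlgebraicGeometry/HodgeTheory`. Let `F ∈ ℂ[x₀, …, x_{n+1}]`,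
`X_F = V₊(F) ⊂ ℙ^{n+1}_ℂ` (`Motives.SmoothHypersurface.hypersurface F`), `G ≤ (ℂˣ)^{n+2}` a subgroup
of diagonal matrices and `χ : G → ℂˣ` a character. Every `a ∈ G` fixing `F` acts on `X_F` by the
algebraic automorphism `[z] ↦ [a • z]` and hence on `Hᵏ(X_F(ℂ); ℂ) = complexBetti X_F k` by pull-back
`g_a^*` (file `DiagonalSymmetry`: `diagonalMap`, its coordinate description and uniqueness). This
file defines

* `ActsDiagonally F a g`: the self-map `g` of `X_F(ℂ)` acts as `x ↦ a • x` on homogeneous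
  coordinates (`rep (pt (g x)) = t • (a • rep (pt x))`) — satisfied exactly by `g = g_a`
  (`actsDiagonally_diagonalMap`, `ActsDiagonally.eq_diagonalMap`);
* **`diagonalCharacterEigenspace F G χ k = V_χ ⊆ Hᵏ(X_F(ℂ); ℂ)`**, the `χ`-eigenspace
  `{c | g_a^* c = χ(a) c for all a ∈ G}`, phrased through `ActsDiagonally` so that no hypothesis on
  `F` or `G` enters the definition (`mem_diagonalCharacterEigenspace_iff_diagonalMap`: for
  `G ≤ diagonalStabilizer F` it is the eigenspace of the maps `g_a`);
* `diagonalPullback F ha k = g_a^*` as a linear endomorphism (a representation of the stabiliser: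
  `diagonalPullback_one`, `diagonalPullback_mul`) and the **isotypic projector**
  `eigenProjector F χ k hG = |G|⁻¹ Σ_{a ∈ G} χ(a)⁻¹ g_a^*`,

and PROVES the character decomposition (Katz 2009 §3: "an `R₀`-linear action of `G` on `M` gives
an eigendecomposition `M = ⊕_{ρ ∈ D(G)} M(ρ)`"): `eigenProjector_mem` (`π_χ c ∈ V_χ`),
`eigenProjector_apply_of_mem` (`π_χ = id` on `V_χ`), `eigenProjector_apply_of_mem_of_ne`
(`π_χ = 0` on `V_ψ`, `ψ ≠ χ`), `sum_eigenProjector_apply` (`Σ_χ π_χ = id`, from the character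
orthogonality `sum_monoidHom_apply_eq_zero` / Mathlib's duality `CommGroup.card_monoidHom_…`),
`iSup_diagonalCharacterEigenspace_eq_top` and `isInternal_diagonalCharacterEigenspace`
(`Hᵏ = ⊕_χ V_χ`); and the rationality statements `IsRationalClass.diagonalMap` (`g_a^*` preserves
rational classes) and `isRationalClass_eigenProjector_add` (`π_χ c + π_{χ⁻¹} c` is rational for
rational `c` when all `χ(a) + χ(a)⁻¹ ∈ ℚ`, e.g. `χ` of order dividing `4` or `6`: the real
cyclotomic field `ℚ(χ)⁺` is `ℚ`).

Consumer: route `HodgeConjecture/DworkPrymHodge` (Dwork sextic fourfold, `G = μ₆⁶ ∩ ker ∏`,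
`χ_b(a) = ∏ aᵢ^{bᵢ}`), where `V_b ⊕ V_{-b}` with its rational classes replaces the inline `IsEig`.
Stability of `V_χ`, `algebraicClasses` and Hodge types under `g_a^*`/`π_χ` (the `g_a` being
algebraic automorphisms) is in the sequel `DiagonalSymmetryClasses`.

## References

* N. M. Katz, *Another look at the Dwork family*, Progr. Math. 269 (2009), §3 (group `Γ_W/Δ`,
  eigendecomposition `M = ⊕ M(ρ)`; Lemma 3.1 for ranks and Hodge numbers of the pieces).
* T. Shioda, *The Hodge conjecture for Fermat varieties*, Math. Ann. 245 (1979), §1.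
* J.-P. Serre, *Linear Representations of Finite Groups*, §2.6 Thm. 8 (canonical decomposition,
  projector `p_χ = (1/g) Σ χ(t)⁻¹ ρ_t` for degree-one `χ`).
-/

noncomputable section

open CategoryTheory AlgebraicGeometry
open scoped LinearAlgebra.Projectivization

namespace Literature.AlgebraicGeometry.HodgeTheory

open Literature.AlgebraicGeometry.Motives Literature.AlgebraicTopology.SingularHomology

variable {n : ℕ}

/-! ### Character sums over a finite commutative group (orthogonality) -/

section CharacterSums

variable {H : Type*} [CommGroup H] [Fintype H]

/-- **Column orthogonality for degree-one characters**: `Σ_χ χ(h) = 0` over all characters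
`χ : H → ℂˣ` of a finite commutative group, for `h ≠ 1` (a character `φ` with `φ(h) ≠ 1` exists by
duality, Mathlib `CommGroup.exists_apply_ne_one_of_hasEnoughRootsOfUnity`, and multiplication by `φ`
permutes the characters). [cite: SerreLinearRepresentations1977, §2.6 Thm. 8] -/
theorem sum_monoidHom_apply_eq_zero [Fintype (H →* ℂˣ)] {h : H} (hh : h ≠ 1) :
    ∑ χ : H →* ℂˣ, (χ h : ℂ) = 0 := by
  obtain ⟨φ, hφ⟩ := CommGroup.exists_apply_ne_one_of_hasEnoughRootsOfUnity H ℂ hh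
  set S := ∑ χ : H →* ℂˣ, (χ h : ℂ) with hS_def
  have hS : (φ h : ℂ) * S = S := by
    rw [hS_def, Finset.mul_sum]
    exact Fintype.sum_bijective (φ * ·) (Group.mulLeft_bijective φ) _ _ fun χ ↦ by
      rw [MonoidHom.mul_apply, Units.val_mul]
  have hφ' : (φ h : ℂ) ≠ 1 := by rwa [Ne, Units.val_eq_one]
  have h0 : ((φ h : ℂ) - 1) * S = 0 := by rw [sub_mul, one_mul, hS, sub_self]
  rcases mul_eq_zero.mp h0 with h1 | h1
  · exact absurd (sub_eq_zero.mp h1) hφ'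
  · exact h1

/-- `Σ_χ χ(1) = |Ĥ| = |H|` (Mathlib `CommGroup.card_monoidHom_of_hasEnoughRootsOfUnity`).
[cite: SerreLinearRepresentations1977, §2.6 Thm. 8] -/
theorem sum_monoidHom_apply_one [Fintype (H →* ℂˣ)] :
    ∑ χ : H →* ℂˣ, (χ (1 : H) : ℂ) = Fintype.card H := by
  simp only [map_one, Units.val_one, Finset.sum_const, Finset.card_univ, nsmul_eq_mul, mul_one]
  rw [← Nat.card_eq_fintype_card, CommGroup.card_monoidHom_of_hasEnoughRootsOfUnity H ℂ,
    Nat.card_eq_fintype_card]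

/-- `Σ_χ χ(h)⁻¹ = |H|` if `h = 1` and `0` otherwise. [cite: SerreLinearRepresentations1977, §2.6 Thm. 8] -/
theorem sum_monoidHom_apply_inv [Fintype (H →* ℂˣ)] [DecidableEq H] (h : H) :
    ∑ χ : H →* ℂˣ, (χ h : ℂ)⁻¹ = if h = 1 then (Fintype.card H : ℂ) else 0 := by
  have key : ∀ χ : H →* ℂˣ, (χ h : ℂ)⁻¹ = (χ h⁻¹ : ℂ) := fun χ ↦ by
    rw [map_inv, Units.val_inv_eq_inv_val]
  simp_rw [key]
  split_ifs with h1
  · rw [h1, inv_one]; exact sum_monoidHom_apply_one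
  · exact sum_monoidHom_apply_eq_zero (inv_ne_one.mpr h1)

/-- **Row orthogonality**: `Σ_{h ∈ H} θ(h) = 0` for a non-trivial character `θ`.
[cite: SerreLinearRepresentations1977, §2.6 Thm. 8] -/
theorem sum_apply_monoidHom_eq_zero {θ : H →* ℂˣ} (hθ : θ ≠ 1) : ∑ h : H, (θ h : ℂ) = 0 := by
  obtain ⟨b, hb⟩ : ∃ b, θ b ≠ 1 := by
    by_contra! hall
    exact hθ (MonoidHom.ext hall)
  set S := ∑ h : H, (θ h : ℂ) with hS_def
  have hS : (θ b : ℂ) * S = S := by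
    rw [hS_def, Finset.mul_sum]
    exact Fintype.sum_bijective (b * ·) (Group.mulLeft_bijective b) _ _ fun h ↦ by
      rw [map_mul, Units.val_mul]
  have hb' : (θ b : ℂ) ≠ 1 := by rwa [Ne, Units.val_eq_one]
  have h0 : ((θ b : ℂ) - 1) * S = 0 := by rw [sub_mul, one_mul, hS, sub_self]
  rcases mul_eq_zero.mp h0 with h1 | h1
  · exact absurd (sub_eq_zero.mp h1) hb'
  · exact h1

end CharacterSums

/-! ### Maps acting diagonally on homogeneous coordinates -/

section Acts

variable (F : MvPolynomial (Fin (n + 2)) ℂ) {a b : Fin (n + 2) → ℂˣ}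

/-- The self-map `g` of `X_F(ℂ)` **acts as `x ↦ a • x` on homogeneous coordinates**: the chosen
representatives of `pt (g x)` and `pt x` (`pt = hypersurfacePoint (hypersurfaceι F)`) satisfy
`rep (pt (g x)) = t • (a • rep (pt x))` for some scalar `t`, i.e. `pt (g x) = [a • z]` whenever
`pt x = [z]`. This is the predicate through which route files quantify over "the" map `g_a`.
[cite: Katz2009, §3] -/
def ActsDiagonally (a : Fin (n + 2) → ℂˣ)
    (g : ComplexPoints (SmoothHypersurface.hypersurface F) → ComplexPoints (SmoothHypersurface.hypersurface F)) :
    Prop :=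
  ∀ x, ∃ t : ℂ, (hypersurfacePoint (SmoothHypersurface.hypersurfaceι F) (g x)).rep =
    t • (a • (hypersurfacePoint (SmoothHypersurface.hypersurfaceι F) x).rep)

/-- Unfolding `ActsDiagonally`. [folklore] -/
theorem actsDiagonally_iff (a : Fin (n + 2) → ℂˣ)
    (g : ComplexPoints (SmoothHypersurface.hypersurface F) → ComplexPoints (SmoothHypersurface.hypersurface F)) :
    ActsDiagonally F a g ↔ ∀ x, ∃ t : ℂ, (hypersurfacePoint (SmoothHypersurface.hypersurfaceι F) (g x)).rep =
      t • (a • (hypersurfacePoint (SmoothHypersurface.hypersurfaceι F) x).rep) :=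
  Iff.rfl

/-- The coordinatewise product with the vector of values of `a` is the action `a • v` (bridge to the
spelling `a * rep (pt x)` with `a : Fin (n+2) → ℂ`). [folklore] -/
@[simp]
theorem val_mul_eq_smul (a : Fin (n + 2) → ℂˣ) (v : Fin (n + 2) → ℂ) :
    (fun i ↦ (a i : ℂ)) * v = a • v := rfl

variable {F}

/-- `g_a` acts as `a` on homogeneous coordinates. [cite: Katz2009, §3] -/
theorem actsDiagonally_diagonalMap (ha : a ∈ diagonalStabilizer F) : ActsDiagonally F a (diagonalMap F ha) :=
  exists_rep_hypersurfacePoint_diagonalMap F ha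

/-- A map acting as `a ∈ diagonalStabilizer F` on homogeneous coordinates IS `g_a`.
[cite: SerreGAGA1956, §2 n°5] -/
theorem ActsDiagonally.eq_diagonalMap (ha : a ∈ diagonalStabilizer F)
    {g : ComplexPoints (SmoothHypersurface.hypersurface F) → ComplexPoints (SmoothHypersurface.hypersurface F)}
    (hg : ActsDiagonally F a g) : g = diagonalMap F ha :=
  eq_diagonalMap_of_forall_exists_rep ha hg

/-- Continuous-map form of `ActsDiagonally.eq_diagonalMap`. [cite: SerreGAGA1956, §2 n°5] -/
theorem ActsDiagonally.continuousMap_eq_diagonalMap (ha : a ∈ diagonalStabilizer F)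
    {g : C(ComplexPoints (SmoothHypersurface.hypersurface F), ComplexPoints (SmoothHypersurface.hypersurface F))}
    (hg : ActsDiagonally F a g) : g = diagonalMap F ha :=
  _root_.Literature.AlgebraicGeometry.HodgeTheory.continuousMap_eq_diagonalMap ha hg

/-- There is exactly one continuous self-map of `X_F(ℂ)` acting as `a ∈ diagonalStabilizer F` on
homogeneous coordinates. [cite: Katz2009, §3] -/
theorem existsUnique_actsDiagonally (ha : a ∈ diagonalStabilizer F) :
    ∃! g : C(ComplexPoints (SmoothHypersurface.hypersurface F), ComplexPoints (SmoothHypersurface.hypersurface F)),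
      ActsDiagonally F a g :=
  ⟨diagonalMap F ha, actsDiagonally_diagonalMap ha, fun _ hg ↦ hg.continuousMap_eq_diagonalMap ha⟩

end Acts

/-! ### The character eigenspace -/

section Eigenspace

variable (F : MvPolynomial (Fin (n + 2)) ℂ) (G : Subgroup (Fin (n + 2) → ℂˣ)) (χ ψ : G →* ℂˣ) (k : ℕ)

/-- **The `χ`-eigenspace `V_χ ⊆ Hᵏ(X_F(ℂ); ℂ)` of a group `G` of diagonal symmetries**: the classes
`c` with `g^* c = χ(a) • c` for every `a ∈ G` and every continuous self-map `g` of `X_F(ℂ)` acting as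
`x ↦ a • x` on homogeneous coordinates (for `G ≤ diagonalStabilizer F` there is exactly one such
`g`, namely `g_a = diagonalMap F _`, `mem_diagonalCharacterEigenspace_iff_diagonalMap`). Katz:
"an `R₀`-linear action of `G` on `M` gives an eigendecomposition `M = ⊕_{ρ ∈ D(G)} M(ρ)` … we denote
by `M(V)` the corresponding eigenspace". [cite: Katz2009, §3] -/
def diagonalCharacterEigenspace : Submodule ℂ (complexBetti (SmoothHypersurface.hypersurface F) k) where
  carrier := {c | ∀ (a : G) (g : C(ComplexPoints (SmoothHypersurface.hypersurface F),
      ComplexPoints (SmoothHypersurface.hypersurface F))),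
    ActsDiagonally F (a : Fin (n + 2) → ℂˣ) g → singularCohomology.map ℂ ℂ g k c = ((χ a : ℂˣ) : ℂ) • c}
  add_mem' {c d} hc hd a g hg := by
    rw [map_add, hc a g hg, hd a g hg, smul_add]
  zero_mem' a g _ := by rw [map_zero, smul_zero]
  smul_mem' t c hc a g hg := by
    rw [map_smul, hc a g hg, smul_comm]

variable {F G χ ψ k}

/-- Membership in `V_χ`, unfolded. [cite: Katz2009, §3] -/
theorem mem_diagonalCharacterEigenspace_iff {c : complexBetti (SmoothHypersurface.hypersurface F) k} :
    c ∈ diagonalCharacterEigenspace F G χ k ↔ ∀ (a : G)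
      (g : C(ComplexPoints (SmoothHypersurface.hypersurface F), ComplexPoints (SmoothHypersurface.hypersurface F))),
      ActsDiagonally F (a : Fin (n + 2) → ℂˣ) g → singularCohomology.map ℂ ℂ g k c = ((χ a : ℂˣ) : ℂ) • c :=
  Iff.rfl

/-- **`V_χ` is the eigenspace of the maps `g_a`**: for `G ≤ diagonalStabilizer F`,
`c ∈ V_χ ↔ g_a^* c = χ(a) • c` for all `a ∈ G`. [cite: Katz2009, §3] -/
theorem mem_diagonalCharacterEigenspace_iff_diagonalMap (hG : G ≤ diagonalStabilizer F)
    {c : complexBetti (SmoothHypersurface.hypersurface F) k} :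
    c ∈ diagonalCharacterEigenspace F G χ k ↔
      ∀ a : G, singularCohomology.map ℂ ℂ (diagonalMap F (hG a.2)) k c = ((χ a : ℂˣ) : ℂ) • c := by
  refine ⟨fun h a ↦ h a _ (actsDiagonally_diagonalMap (hG a.2)), fun h a g hg ↦ ?_⟩
  rw [hg.continuousMap_eq_diagonalMap (hG a.2)]
  exact h a

/-- If some scalar symmetry `(u, …, u) ∈ G` has `χ(u, …, u) ≠ 1` then `V_χ = 0` (scalars act
trivially on `ℙ^{n+1}`; Katz: "the diagonal subgroup `Δ` acts trivially", so only characters of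
`G/(G ∩ Δ)` contribute). [cite: Katz2009, §3] -/
theorem diagonalCharacterEigenspace_eq_bot_of_const (hG : G ≤ diagonalStabilizer F) {u : ℂˣ}
    (hu : (fun _ ↦ u : Fin (n + 2) → ℂˣ) ∈ G) (hχ : χ ⟨_, hu⟩ ≠ 1) :
    diagonalCharacterEigenspace F G χ k = ⊥ := by
  refine (Submodule.eq_bot_iff _).mpr fun c hc ↦ ?_
  have h := (mem_diagonalCharacterEigenspace_iff_diagonalMap hG).mp hc ⟨_, hu⟩
  rw [diagonalMap_const (hG hu), singularCohomology.map_id] at h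
  have h' : (1 - ((χ ⟨_, hu⟩ : ℂˣ) : ℂ)) • c = 0 := by
    rw [sub_smul, one_smul, sub_eq_zero]; exact h
  refine (smul_eq_zero.mp h').resolve_left (sub_ne_zero.mpr ?_)
  exact fun h1 ↦ hχ (Units.val_eq_one.mp h1.symm)

end Eigenspace

/-! ### Pull-back by `g_a` as a linear endomorphism; the isotypic projectors -/

section Projector

variable (F : MvPolynomial (Fin (n + 2)) ℂ) {G : Subgroup (Fin (n + 2) → ℂˣ)} {a b : Fin (n + 2) → ℂˣ}

/-- `g_a^* : Hᵏ(X_F(ℂ); ℂ) → Hᵏ(X_F(ℂ); ℂ)` as a `ℂ`-linear endomorphism (pull-back along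
`diagonalMap F ha`; it is `complexBetti.map (diagonalAut F ha) k` of `GysinFormalism`, definitionally).
[cite: Katz2009, §3] -/
def diagonalPullback (ha : a ∈ diagonalStabilizer F) (k : ℕ) :
    Module.End ℂ (complexBetti (SmoothHypersurface.hypersurface F) k) :=
  (singularCohomology.map ℂ ℂ (diagonalMap F ha) k).hom

/-- `diagonalPullback F ha k c = g_a^* c`. [folklore] -/
@[simp]
theorem diagonalPullback_apply (ha : a ∈ diagonalStabilizer F) (k : ℕ)
    (c : complexBetti (SmoothHypersurface.hypersurface F) k) :
    diagonalPullback F ha k c = singularCohomology.map ℂ ℂ (diagonalMap F ha) k c := rfl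

/-- `g_1^* = id`. [folklore] -/
theorem diagonalPullback_one (k : ℕ) : diagonalPullback F (one_mem (diagonalStabilizer F)) k = 1 := by
  refine LinearMap.ext fun c ↦ ?_
  rw [diagonalPullback_apply, diagonalMap_one, singularCohomology.map_id]
  rfl

/-- `g_b^* (g_a^* c) = g_{ab}^* c` (contravariance: `(g_a ∘ g_b)^* = g_b^* ∘ g_a^*`). [folklore] -/
theorem map_diagonalMap_map_diagonalMap (ha : a ∈ diagonalStabilizer F) (hb : b ∈ diagonalStabilizer F) (k : ℕ)
    (c : complexBetti (SmoothHypersurface.hypersurface F) k) :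
    singularCohomology.map ℂ ℂ (diagonalMap F hb) k (singularCohomology.map ℂ ℂ (diagonalMap F ha) k c) =
      singularCohomology.map ℂ ℂ (diagonalMap F (mul_mem ha hb)) k c := by
  rw [diagonalMap_mul ha hb, singularCohomology.map_comp]
  rfl

/-- `g_{ab}^* = g_b^* ∘ g_a^*`: `a ↦ g_a^*` is a representation of the (commutative) stabiliser.
[folklore] -/
theorem diagonalPullback_mul (ha : a ∈ diagonalStabilizer F) (hb : b ∈ diagonalStabilizer F) (k : ℕ) :
    diagonalPullback F (mul_mem ha hb) k = diagonalPullback F hb k * diagonalPullback F ha k :=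
  LinearMap.ext fun c ↦ (map_diagonalMap_map_diagonalMap F ha hb k c).symm

/-- The `g_a^*` commute. [folklore] -/
theorem diagonalPullback_comm (ha : a ∈ diagonalStabilizer F) (hb : b ∈ diagonalStabilizer F) (k : ℕ) :
    diagonalPullback F ha k * diagonalPullback F hb k = diagonalPullback F hb k * diagonalPullback F ha k := by
  rw [← diagonalPullback_mul, ← diagonalPullback_mul]
  congr 1
  exact mul_comm b a

/-- **Rational classes pull back to rational classes under `g_a`**: `g_a^*[z] = [g_a^♯ z]` and
`(g_a^♯ z)(σ) = z(g_a ∘ σ) ∈ ℚ` (the general functoriality is `IsRationalClass.map`; proved here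
directly so that this file stays in the light import cone of `RationalHodgeClasses`).
[cite: HatcherAT2002, §3.1 p. 198] -/
theorem IsRationalClass.diagonalMap (ha : a ∈ diagonalStabilizer F) {k : ℕ}
    {c : complexBetti (SmoothHypersurface.hypersurface F) k} (hc : IsRationalClass c) :
    IsRationalClass (singularCohomology.map ℂ ℂ (diagonalMap F ha) k c) := by
  obtain ⟨z, rfl, hz⟩ := hc
  refine ⟨singularCochainComplex.cocyclesMap ℂ ℂ (HodgeTheory.diagonalMap F ha) k z,
    (singularCohomology.map_π (HodgeTheory.diagonalMap F ha) z).symm, fun σ ↦ ?_⟩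
  rw [singularCochainComplex.iCocycles_cocyclesMap, singularCochainComplex.map_apply]
  exact hz _

variable (χ ψ : G →* ℂˣ) (k : ℕ) [Fintype G] (hG : G ≤ diagonalStabilizer F)

/-- **The isotypic projector `π_χ = |G|⁻¹ Σ_{a ∈ G} χ(a)⁻¹ g_a^*`** of a finite group of diagonal
symmetries of `F` (Serre, *Linear Representations* §2.6: `p_χ = (n_χ/g) Σ_t χ(t)^* ρ_t`, degree one).
[cite: SerreLinearRepresentations1977, §2.6 Thm. 8] -/
def eigenProjector : Module.End ℂ (complexBetti (SmoothHypersurface.hypersurface F) k) :=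
  (Fintype.card G : ℂ)⁻¹ • ∑ a : G, ((χ a : ℂˣ) : ℂ)⁻¹ • diagonalPullback F (hG a.2) k

/-- Pointwise formula for `π_χ`. [cite: SerreLinearRepresentations1977, §2.6 Thm. 8] -/
theorem eigenProjector_apply (c : complexBetti (SmoothHypersurface.hypersurface F) k) :
    eigenProjector F χ k hG c = (Fintype.card G : ℂ)⁻¹ •
      ∑ a : G, ((χ a : ℂˣ) : ℂ)⁻¹ • singularCohomology.map ℂ ℂ (diagonalMap F (hG a.2)) k c := by
  simp only [eigenProjector, LinearMap.smul_apply, LinearMap.coe_sum, Finset.sum_apply,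
    diagonalPullback_apply]

variable {χ ψ k}

/-- **`π_χ` lands in `V_χ`**: `g_b^* π_χ c = |G|⁻¹ Σ_a χ(a)⁻¹ g_{ab}^* c = χ(b) π_χ c` (reindex
`a ↦ ab`). [cite: SerreLinearRepresentations1977, §2.6 Thm. 8] -/
theorem eigenProjector_mem (c : complexBetti (SmoothHypersurface.hypersurface F) k) :
    eigenProjector F χ k hG c ∈ diagonalCharacterEigenspace F G χ k := by
  rw [mem_diagonalCharacterEigenspace_iff_diagonalMap hG]
  intro b
  rw [eigenProjector_apply, map_smul, map_sum, smul_comm]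
  congr 1
  rw [Finset.smul_sum]
  simp_rw [map_smul, map_diagonalMap_map_diagonalMap]
  refine Fintype.sum_equiv (Equiv.mulRight b) _ _ fun a ↦ ?_
  rw [Equiv.coe_mulRight, smul_smul, map_mul, Units.val_mul, mul_inv, mul_left_comm,
    mul_inv_cancel₀ (Units.ne_zero _), mul_one]

/-- **`π_χ` is the identity on `V_χ`.** [cite: SerreLinearRepresentations1977, §2.6 Thm. 8] -/
theorem eigenProjector_apply_of_mem {c : complexBetti (SmoothHypersurface.hypersurface F) k}
    (hc : c ∈ diagonalCharacterEigenspace F G χ k) : eigenProjector F χ k hG c = c := by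
  rw [eigenProjector_apply]
  have h := (mem_diagonalCharacterEigenspace_iff_diagonalMap hG).mp hc
  have h' : ∀ a : G, ((χ a : ℂˣ) : ℂ)⁻¹ • singularCohomology.map ℂ ℂ (diagonalMap F (hG a.2)) k c = c :=
    fun a ↦ by rw [h a, smul_smul, inv_mul_cancel₀ (Units.ne_zero _), one_smul]
  simp_rw [h']
  rw [Finset.sum_const, Finset.card_univ, ← Nat.cast_smul_eq_nsmul ℂ, smul_smul,
    inv_mul_cancel₀ (Nat.cast_ne_zero.mpr Fintype.card_ne_zero : (Fintype.card G : ℂ) ≠ 0), one_smul]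

/-- **`π_χ` kills `V_ψ` for `ψ ≠ χ`** (row orthogonality `Σ_a (ψχ⁻¹)(a) = 0`).
[cite: SerreLinearRepresentations1977, §2.6 Thm. 8] -/
theorem eigenProjector_apply_of_mem_of_ne {c : complexBetti (SmoothHypersurface.hypersurface F) k}
    (hc : c ∈ diagonalCharacterEigenspace F G ψ k) (hne : ψ ≠ χ) : eigenProjector F χ k hG c = 0 := by
  rw [eigenProjector_apply]
  have h := (mem_diagonalCharacterEigenspace_iff_diagonalMap hG).mp hc
  simp_rw [h, smul_smul, ← Finset.sum_smul]
  have hθ : ψ * χ⁻¹ ≠ 1 := fun h1 ↦ hne (mul_inv_eq_one.mp h1)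
  have hsum : ∑ a : G, ((χ a : ℂˣ) : ℂ)⁻¹ * ((ψ a : ℂˣ) : ℂ) = 0 := by
    rw [← sum_apply_monoidHom_eq_zero hθ]
    refine Finset.sum_congr rfl fun a _ ↦ ?_
    rw [MonoidHom.mul_apply, MonoidHom.inv_apply, Units.val_mul, Units.val_inv_eq_inv_val, mul_comm]
  rw [hsum, zero_smul, smul_zero]

/-- **`Σ_χ π_χ = id`**: `Σ_χ |G|⁻¹ Σ_a χ(a)⁻¹ g_a^* = |G|⁻¹ Σ_a (Σ_χ χ(a⁻¹)) g_a^* = g_1^* = id` by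
column orthogonality and `|Ĝ| = |G|`. [cite: SerreLinearRepresentations1977, §2.6 Thm. 8] -/
theorem sum_eigenProjector_apply [Fintype (G →* ℂˣ)] (c : complexBetti (SmoothHypersurface.hypersurface F) k) :
    ∑ χ : G →* ℂˣ, eigenProjector F χ k hG c = c := by
  classical
  simp_rw [eigenProjector_apply]
  rw [← Finset.smul_sum, Finset.sum_comm]
  simp_rw [← Finset.sum_smul, sum_monoidHom_apply_inv, ite_smul, zero_smul, Finset.sum_ite_eq',
    Finset.mem_univ, if_true, smul_smul,
    inv_mul_cancel₀ (Nat.cast_ne_zero.mpr Fintype.card_ne_zero : (Fintype.card G : ℂ) ≠ 0), one_smul]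
  have h1 : diagonalMap F (hG (1 : G).2) = ContinuousMap.id _ := diagonalMap_one
  rw [h1, singularCohomology.map_id]
  rfl

include hG in
/-- **The eigenspaces span**: `⨆_χ V_χ = Hᵏ(X_F(ℂ); ℂ)`. [cite: Katz2009, §3] -/
theorem iSup_diagonalCharacterEigenspace_eq_top [Fintype (G →* ℂˣ)] :
    ⨆ χ : G →* ℂˣ, diagonalCharacterEigenspace F G χ k = ⊤ := by
  refine eq_top_iff.mpr fun c _ ↦ ?_
  rw [← sum_eigenProjector_apply F hG c]
  exact Submodule.sum_mem _ fun χ _ ↦ Submodule.mem_iSup_of_mem χ (eigenProjector_mem F hG c)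

include hG in
/-- **The eigenspaces are independent**: a class in `V_χ ∩ Σ_{ψ ≠ χ} V_ψ` is `π_χ` of itself and
killed by `π_χ`. [cite: Katz2009, §3] -/
theorem iSupIndep_diagonalCharacterEigenspace :
    iSupIndep fun χ : G →* ℂˣ ↦ diagonalCharacterEigenspace F G χ k := by
  intro χ
  refine Submodule.disjoint_def.mpr fun c hc hc' ↦ ?_
  rw [← eigenProjector_apply_of_mem F hG hc]
  refine Submodule.iSup_induction (fun ψ ↦ ⨆ (_ : ψ ≠ χ), diagonalCharacterEigenspace F G ψ k)
    (motive := fun d ↦ eigenProjector F χ k hG d = 0) hc' (fun ψ d hd ↦ ?_) (map_zero _) fun d e hd he ↦ by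
      rw [map_add, hd, he, add_zero]
  by_cases hψ : ψ ≠ χ
  · rw [iSup_pos hψ] at hd
    exact eigenProjector_apply_of_mem_of_ne F hG hd hψ
  · rw [iSup_neg hψ, Submodule.mem_bot] at hd
    rw [hd, map_zero]

include hG in
/-- **Character decomposition `Hᵏ(X_F(ℂ); ℂ) = ⊕_χ V_χ`** for a finite group `G ≤ diagonalStabilizer F`
of diagonal symmetries (Katz: "`M = ⊕_{ρ ∈ D(G)} M(ρ)`"). [cite: Katz2009, §3] -/
theorem isInternal_diagonalCharacterEigenspace [Fintype (G →* ℂˣ)] [DecidableEq (G →* ℂˣ)] :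
    DirectSum.IsInternal fun χ : G →* ℂˣ ↦ diagonalCharacterEigenspace F G χ k :=
  (DirectSum.isInternal_submodule_iff_iSupIndep_and_iSup_eq_top _).mpr
    ⟨iSupIndep_diagonalCharacterEigenspace F hG, iSup_diagonalCharacterEigenspace_eq_top F hG⟩

/-- `π_χ ∘ π_χ = π_χ`. [cite: SerreLinearRepresentations1977, §2.6 Thm. 8] -/
theorem eigenProjector_idem (c : complexBetti (SmoothHypersurface.hypersurface F) k) :
    eigenProjector F χ k hG (eigenProjector F χ k hG c) = eigenProjector F χ k hG c :=
  eigenProjector_apply_of_mem F hG (eigenProjector_mem F hG c)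

/-- The image of `π_χ` is exactly `V_χ`. [cite: SerreLinearRepresentations1977, §2.6 Thm. 8] -/
theorem range_eigenProjector : LinearMap.range (eigenProjector F χ k hG) = diagonalCharacterEigenspace F G χ k :=
  le_antisymm (by rintro _ ⟨c, rfl⟩; exact eigenProjector_mem F hG c)
    fun c hc ↦ ⟨c, eigenProjector_apply_of_mem F hG hc⟩

/-! ### Rationality of paired projectors -/

/-- **`π_χ c + π_{χ⁻¹} c` is a rational class** for `c` rational, provided every `χ(a) + χ(a)⁻¹` is
rational (true when `χ` takes values in `μ_m`, `m ∣ 4` or `m ∣ 6`, as `ζ + ζ⁻¹ ∈ {±2, ±1, 0}`):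
`π_χ c + π_{χ⁻¹} c = |G|⁻¹ Σ_a (χ(a)⁻¹ + χ(a)) g_a^* c` with rational coefficients and rational
`g_a^* c` (`IsRationalClass.diagonalMap`). This is the statement "rational classes of `V_χ ⊕ V_{χ̄}`
form its `ℚ`-structure when `ℚ(χ)⁺ = ℚ`" used for the Dwork sextic. [cite: Katz2009, §3] -/
theorem isRationalClass_eigenProjector_add {c : complexBetti (SmoothHypersurface.hypersurface F) k}
    (hc : IsRationalClass c) (hχ : ∀ a : G, ∃ q : ℚ, (q : ℂ) = ((χ a : ℂˣ) : ℂ) + ((χ a : ℂˣ) : ℂ)⁻¹) :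
    IsRationalClass (eigenProjector F χ k hG c + eigenProjector F χ⁻¹ k hG c) := by
  classical
  rw [eigenProjector_apply, eigenProjector_apply, ← smul_add, ← Finset.sum_add_distrib]
  have hcard : (((Fintype.card G : ℚ)⁻¹ : ℚ) : ℂ) = (Fintype.card G : ℂ)⁻¹ := by
    rw [Rat.cast_inv, Rat.cast_natCast]
  rw [← hcard]
  refine IsRationalClass.smul ?_ _
  -- each summand `(χ(a)⁻¹ + χ(a)) • g_a^* c` is rational
  have hsum : ∀ s : Finset G, IsRationalClass (∑ a ∈ s, (((χ a : ℂˣ) : ℂ)⁻¹ •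
      singularCohomology.map ℂ ℂ (diagonalMap F (hG a.2)) k c +
      ((χ⁻¹ a : ℂˣ) : ℂ)⁻¹ • singularCohomology.map ℂ ℂ (diagonalMap F (hG a.2)) k c)) := by
    intro s
    induction s using Finset.induction_on with
    | empty => rw [Finset.sum_empty]; exact IsRationalClass.zero
    | insert a s has ih =>
      rw [Finset.sum_insert has]
      refine IsRationalClass.add ?_ ih
      obtain ⟨q, hq⟩ := hχ a
      rw [← add_smul, MonoidHom.inv_apply, Units.val_inv_eq_inv_val, inv_inv, add_comm, ← hq]
      exact (hc.diagonalMap F (hG a.2)).smul q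
  exact hsum Finset.univ

end Projector

end Literature.AlgebraicGeometry.HodgeTheory

end
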